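/-
Copyright (c) 2026 the pub-hodgecm-mathlib formalisation cell (harness21).  Prover seat hodgecm-mathlib-LH4-p16 (g3), req620 Track A «(D-RAM) FOUR-FRAME» squad
((β₂) road (R-36), the K6 road — K6 DESK WORD #14 «ARCHITECTURE A» step (2)→(3): the per-cell law of ★ F1b p864627 (LH4-p18 (g4)) at the cell's own digit precision is carried
to the row's COMMON fine digit system by ★ K6-(r) p864684 (LH7-p06 (g3))), 2026-09-05.
-/
import Summits.HodgeConjecture.HodgeConjecture.Theorems.F0P3cDyRamRowTowerCellPerCellValue    -- ★ F1b p864627 (LH4-p18 (g4)): `normSign_affine_eq_of_sub_le` (the label is a class function); brings the line-model vocabulary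
import Summits.HodgeConjecture.HodgeConjecture.Theorems.F0P3cDyRamDigitRefinementTransfer     -- ★ K6-(r) p864684 (LH7-p06 (g3)): `card_filter_fine_eq_mul`, `sum_filter_fine_eq_mul`
import Summits.HodgeConjecture.HodgeConjecture.Theorems.F0P3cDyRamRowCellDigitClassTwist        -- ★ Q1a p864536 (LH7-p08 (g3)): `classClause_iff_of_near`; brings ★ p864361 `v_traceOne_add_map_mul_anti_eq_max`
import HarnessLib

/-!
# Crux `H413`, line LH4 «(D-RAM) FOUR-FRAME» — (β₂) road, K6 ARCHITECTURE A (2)→(3): «THE CELL LAW AT THE COMMON RESOLUTION» — the per-cell identity `X·#S = n·(p·Σ_S ω)` of a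
# live-row cell, proved by ★ F1b on a digit system of the CELL's precision `|ϖ|^n`, holds VERBATIM on any FINER complete digit system (precision `|ϖ|^{nf}`, `n ≤ nf`): both
# `#S` and `Σ_S ω` scale by the same fibre count (★ K6-(r)), because the literal predicate (sphere ∧ class) and the label character are CLASS FUNCTIONS at precision `|ϖ|^n`

Cell `hodgecm-mathlib` (D-0151), FLOOR 0, crux item H413 = `stmt-HodgeConjecture-24833`, route of record `HCCMUnconditional`; squad F0∕P3c∕LH4 (hand LH4-p16 (g3), the K6 desk);
lane `--supports stmt-HodgeConjecture-24833 --as helper` (count-neutral; pays NO tier-0 row).  THEOREMS ONLY (no `def`, no instance, no notation, no `sorry`, default heartbeats);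
★-only imports; states NO law.

WHY (K6 DESK WORD #14).  ★ F1b's precision letters give each inside cell `i` of the live row its own digit modulus `r_i = |ϖ|^{b + 2(N−1−i)}` (window `[hrfloor, hrR)`), while the spine
(★ HEAD₃ `coreWindow_of_cellValues_sphere`, the partition, the density ★ p864447, the digit sum ★ p864489) lives on ONE digit system `Rd⋆` of the finest modulus.  ★ K6-(r)
`card_filter_fine_eq_mul` ∕ `sum_filter_fine_eq_mul` transport `#` and `Σ` from coarse to fine by the common fibre count `ρ = #(Rd⋆ ∩ |ϖ|^n-ball)` for every predicate ∕ function that is a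
class function mod `|ϖ|^n` on the fixed unit ball; §2–§3 show that ★ F1b's literal predicate `LIT V₀ :≡ (|κ₀ + jE V₀·ξ₀|·|jEϖ^j(α − ρα)| = |jEϖ|^b) ∧ (Q(κ₀ + jE V₀·ξ₀)∕c ∈ 𝒩)` IS such a
class function under F1b's own precision letters (`hrR` — the sphere is stable; `hr₀`-type at the conductor `|jEϖ|^{2d−1}` — the class is stable ON the sphere, ★ `classClause_iff_of_near`),
and ★ F1b §2 says the same of the label `ω(α₁ + γ₁V)` under `hrγ`.  HEAD §4 `cellLaw_fine_of_coarse`: the identity `X·#(Rd.filter P) = n·(p·Σ_{(Rd.filter P).filter ⊤} ω)` (★ F1b's output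
shape, `P ↔ LIT`) implies `X·#(Rd⋆.filter P) = n·(p·Σ_{Rd⋆.filter P} ω)` — ★ §3 `cellValue_of_perCellLaw`'s `hmul` at the common resolution.
WHAT IS NOT CLAIMED: any cell value (★ F1b), the density (★ p864447 + (d″)), the partition, the top cell.
HONEST LABEL.  Count-neutral digit bookkeeping over ★ heads; nothing printed is asserted; ‹CORE›∕‹CORE-ODD›, β₂ stay HYPOTHESES; `HC_CM` is proved only modulo the 7 printed citations
(2 remaining named inputs: hLiu418 = `stmt-HodgeConjecture-24832`, h413 = `stmt-HodgeConjecture-24833`) until rung 0 closes.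
## References
* [Kottwitz1986BaseChangeUnits] R. E. Kottwitz, *Base change for unit elements of Hecke algebras*, Compositio Math. 60 (1986): §1 pp. 240–241 (cell-by-cell fixed-lattice counts).
* [Serre1979] J.-P. Serre, *Local Fields*, GTM 67 (1979): Ch. IV §2 Prop. 6 (digit systems); Ch. V §3 Cor. 3 pp. 84–86 (norm-residue sign and its conductor).
* [Rogawski1990] J. D. Rogawski, *Automorphic Representations of Unitary Groups in Three Variables*, Ann. of Math. Stud. 123 (1990): §4.9 Prop. 4.9.1 (b) p. 55.
-/

set_option autoImplicit false

noncomputable section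

namespace Summit.HodgeConjecture.HodgeConjecture.Cruxes.H413.F0P3cDyRamCellLawCommonResolution

open scoped Valued WithZero Classical
open WithZero Finset
open Literature.NumberTheory.Automorphic.UnitaryThreeFourFrame (IsRamifiedQuadraticDatum normSign)
open Summit.HodgeConjecture.HodgeConjecture.Cruxes.H413.F0P3cDyRamRowTowerCellPerCellValue (normSign_affine_eq_of_sub_le)
open Summit.HodgeConjecture.HodgeConjecture.Cruxes.H413.F0P3cDyRamDigitRefinementTransfer (card_filter_fine_eq_mul sum_filter_fine_eq_mul)
open Summit.HodgeConjecture.HodgeConjecture.Cruxes.H413.F0P3cDyRamRowCellDigitClassTwist (classClause_iff_of_near)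
open Summit.HodgeConjecture.HodgeConjecture.Cruxes.H413.F0P3cDyRamRowCellDigitShellDictionary (v_traceOne_add_map_mul_anti_eq_max)

variable {E M : Type} [Field E] [Valued E ℤᵐ⁰] [Field M] [Valued M ℤᵐ⁰] {ρ Θ : M →+* M} {α : M}

/-! ## §1 The abstract transfer: a K6-0-shaped law scales from a coarse to a fine digit system -/

omit [Field M] [Valued M ℤᵐ⁰] in
/-- **THE CELL LAW IS RESOLUTION-COVARIANT.**  Two complete irredundant digit systems `Rd` (mod `|ϖ|^n`) and `Rdf` (mod `|ϖ|^{nf}`, `n ≤ nf`) of the fixed unit ball; a predicate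
`P` and a function `F` that are class functions mod `|ϖ|^n`.  THEN the law `X·#(Rd.filter P) = N·(p·Σ_{(Rd.filter P).filter ⊤} F)` (★ F1b's output shape, `NX := ⊤`) implies
`X·#(Rdf.filter P) = N·(p·Σ_{Rdf.filter P} F)`: both sides scale by ★ K6-(r)'s fibre count. [cite: Serre1979, Ch. IV §2 Prop. 6] [cite: Kottwitz1986BaseChangeUnits, §1 pp. 240–241] -/
theorem mul_card_eq_mul_sum_fine_of_coarse {σ : E →+* E} {ϖ : E} (hϖ : Valued.v ϖ = exp (-1 : ℤ)) (Rd Rdf : Finset E) {n nf : ℕ} (hle : n ≤ nf)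
    (hRd1 : ∀ V ∈ Rd, σ V = V ∧ Valued.v V ≤ 1)
    (hRd2 : ∀ V : E, σ V = V → Valued.v V ≤ 1 → ∃ V₀ ∈ Rd, Valued.v (V - V₀) ≤ Valued.v ϖ ^ n)
    (hRd3 : ∀ V ∈ Rd, ∀ V' ∈ Rd, Valued.v (V - V') ≤ Valued.v ϖ ^ n → V = V')
    (hRdf1 : ∀ V ∈ Rdf, σ V = V ∧ Valued.v V ≤ 1)
    (hRdf2 : ∀ V : E, σ V = V → Valued.v V ≤ 1 → ∃ V₀ ∈ Rdf, Valued.v (V - V₀) ≤ Valued.v ϖ ^ nf)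
    (hRdf3 : ∀ V ∈ Rdf, ∀ V' ∈ Rdf, Valued.v (V - V') ≤ Valued.v ϖ ^ nf → V = V')
    (P : E → Prop) [DecidablePred P]
    (hP : ∀ V V' : E, σ V = V → Valued.v V ≤ 1 → σ V' = V' → Valued.v V' ≤ 1 → Valued.v (V - V') ≤ Valued.v ϖ ^ n → (P V ↔ P V'))
    (F : E → ℤ)
    (hF : ∀ V V' : E, σ V = V → Valued.v V ≤ 1 → σ V' = V' → Valued.v V' ≤ 1 → Valued.v (V - V') ≤ Valued.v ϖ ^ n → F V = F V')
    (X N' p : ℤ) (hlaw : X * ((Rd.filter P).card : ℤ) = N' * (p * ∑ V ∈ (Rd.filter P).filter (fun _ => True), F V)) :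
    X * ((Rdf.filter P).card : ℤ) = N' * (p * ∑ V ∈ Rdf.filter P, F V) := by
  rw [Finset.filter_true] at hlaw
  rw [card_filter_fine_eq_mul hϖ Rd Rdf hle hRd1 hRd2 hRd3 hRdf1 hRdf2 hRdf3 P hP, sum_filter_fine_eq_mul hϖ Rd Rdf hle hRd1 hRd2 hRd3 hRdf1 hRdf2 hRdf3 P hP F hF]
  push_cast
  linear_combination ((Rdf.filter fun V => Valued.v V ≤ Valued.v ϖ ^ n).card : ℤ) * hlaw

/-! ## §2 The sphere clause of a cell is a class function at the cell's precision -/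

/-- **THE SPHERE IS STABLE UNDER DIGIT PERTURBATIONS BELOW ITS RADIUS**: with `κ = κ₀ + jE V·ξ₀`, `κ′ = κ₀ + jE V′·ξ₀` and `|V − V′|·|ξ₀|·|C| < y`:
`|κ|·|C| = y ↔ |κ′|·|C| = y` (ultrametric: the perturbation `jE(V′ − V)·ξ₀` is strictly below the sphere). [cite: Serre1979, Ch. IV §2 Prop. 6] -/
theorem sphereClause_iff_of_lt (jE : E →+* M) (hjiso : ∀ a, Valued.v (jE a) = Valued.v a) (κ₀ ξ₀ C : M) (y : ℤᵐ⁰) {r : ℤᵐ⁰}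
    (hrR : r * Valued.v ξ₀ * Valued.v C < y) {V V' : E} (hVV' : Valued.v (V - V') ≤ r) :
    (Valued.v (κ₀ + jE V * ξ₀) * Valued.v C = y ↔ Valued.v (κ₀ + jE V' * ξ₀) * Valued.v C = y) := by
  -- the perturbation and its size
  have hδ : ∀ W W' : E, Valued.v (W - W') ≤ r → Valued.v (jE (W' - W) * ξ₀) * Valued.v C < y := by
    intro W W' hW
    rw [Valuation.map_mul, hjiso, ← Valuation.map_neg, neg_sub]
    calc Valued.v (W - W') * Valued.v ξ₀ * Valued.v C ≤ r * Valued.v ξ₀ * Valued.v C := by gcongr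
      _ < y := hrR
  -- one direction suffices by symmetry
  have key : ∀ W W' : E, Valued.v (W - W') ≤ r → Valued.v (κ₀ + jE W * ξ₀) * Valued.v C = y →
      Valued.v (κ₀ + jE W' * ξ₀) * Valued.v C = y := by
    intro W W' hW hS
    have e : κ₀ + jE W' * ξ₀ = (κ₀ + jE W * ξ₀) + jE (W' - W) * ξ₀ := by rw [map_sub]; ring
    have hlt : Valued.v (jE (W' - W) * ξ₀) < Valued.v (κ₀ + jE W * ξ₀) := by
      refine lt_of_not_ge fun hle => ?_
      have h1 : y ≤ Valued.v (jE (W' - W) * ξ₀) * Valued.v C := by rw [← hS]; gcongr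
      exact absurd (hδ W W' hW) (not_lt.2 h1)
    rw [e, Valuation.map_add_eq_of_lt_left _ hlt, hS]
  refine ⟨key V V' hVV', key V' V ?_⟩
  rw [← Valuation.map_neg, neg_sub]; exact hVV'

/-! ## §3 The literal predicate (sphere ∧ class) is a class function at the cell's precision -/

/-- **THE LITERAL PREDICATE IS A CLASS FUNCTION MOD `r`.**  Chart `(κ₀, ξ₀)` with `κ₀` trace-one of size `1`, `Θ`-fixed, `ξ₀` anti `Θ`-fixed; `σ`-fixed digits `V, V′` with `|V − V′| ≤ r`;
precision letters `hrR : r·|ξ₀|·|C| < y` (sphere stable) and `hr₀ : r·|ξ₀|·|C| ≤ |jEϖ|^{2d−1}·y` (`y` the sphere value, e.g. `|jEϖ|^b`) (on the sphere the perturbation is below the conductor relative to `|κ|`, ★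
`classClause_iff_of_near`).  THEN `(SPH V ∧ CLS V) ↔ (SPH V′ ∧ CLS V′)` for `SPH W :≡ |κ₀ + jE W·ξ₀|·|C| = y`, `CLS W :≡ Q(κ₀ + jE W·ξ₀)∕c ∈ 𝒩`.
[cite: Serre1979, Ch. V §3 Cor. 3 pp. 84–86] [cite: Kottwitz1986BaseChangeUnits, §1 pp. 240–241] -/
theorem lit_iff_lit_of_near [CompleteSpace E] {σ : E →+* E} {ϖ : E} {d tE : ℕ} (hD : IsRamifiedQuadraticDatum σ ϖ d tE)
    (jE : E →+* M) (hjfix : ∀ z, ρ z = z ↔ ∃ c, jE c = z) (hΘj : ∀ c, Θ (jE c) = jE (σ c)) (hjiso : ∀ a, Valued.v (jE a) = Valued.v a)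
    (hρρ : ∀ x, ρ (ρ x) = x) (hvρ : ∀ x, Valued.v (ρ x) = Valued.v x) (hΘρ : ∀ x, Θ (ρ x) = ρ (Θ x))
    {κ₀ ξ₀ : M} (hκ₀ : κ₀ + ρ κ₀ = 1) (hΘκ₀ : Θ κ₀ = κ₀) (hκ₀1 : Valued.v κ₀ = 1) (hξ : ρ ξ₀ = -ξ₀) (hΘξ : Θ ξ₀ = ξ₀)
    (c C : M) (y : ℤᵐ⁰) (hC : Valued.v C ≠ 0) {r : ℤᵐ⁰}
    (hrR : r * Valued.v ξ₀ * Valued.v C < y) (hr₀ : r * Valued.v ξ₀ * Valued.v C ≤ Valued.v (jE ϖ) ^ (2 * d - 1) * y)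
    {V V' : E} (hσV : σ V = V) (hσV' : σ V' = V') (hVV' : Valued.v (V - V') ≤ r) :
    ((Valued.v (κ₀ + jE V * ξ₀) * Valued.v C = y ∧ ∃ e : M, ρ e = e ∧ e * Θ e = (κ₀ + jE V * ξ₀) * ρ (κ₀ + jE V * ξ₀) / c) ↔
      (Valued.v (κ₀ + jE V' * ξ₀) * Valued.v C = y ∧ ∃ e : M, ρ e = e ∧ e * Θ e = (κ₀ + jE V' * ξ₀) * ρ (κ₀ + jE V' * ξ₀) / c)) := by
  have hρj : ∀ a : E, ρ (jE a) = jE a := fun a => (hjfix _).2 ⟨a, rfl⟩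
  have hsph := sphereClause_iff_of_lt jE hjiso κ₀ ξ₀ C y hrR hVV'
  -- `Θ`-fixedness of the two points and non-vanishing (`|κ| ≥ 1`)
  have hΘκ : ∀ W : E, σ W = W → Θ (κ₀ + jE W * ξ₀) = κ₀ + jE W * ξ₀ := fun W hW => by rw [map_add, map_mul, hΘκ₀, hΘj, hW, hΘξ]
  have hκ0 : ∀ W : E, κ₀ + jE W * ξ₀ ≠ 0 := fun W h0 => by
    have h1 := v_traceOne_add_map_mul_anti_eq_max hvρ jE hρj hjiso hκ₀ hκ₀1 hξ W
    rw [h0, Valuation.map_zero] at h1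
    exact absurd (h1.symm ▸ le_max_left 1 (Valued.v W * Valued.v ξ₀)) (not_le.2 zero_lt_one)
  -- on the sphere, the perturbation is below the conductor relative to `|κ|`
  have hnear : ∀ W W' : E, Valued.v (W - W') ≤ r → Valued.v (κ₀ + jE W * ξ₀) * Valued.v C = y →
      Valued.v ((κ₀ + jE W' * ξ₀) - (κ₀ + jE W * ξ₀)) ≤ Valued.v (jE ϖ) ^ (2 * d - 1) * Valued.v (κ₀ + jE W * ξ₀) := by
    intro W W' hW hS
    have e : (κ₀ + jE W' * ξ₀) - (κ₀ + jE W * ξ₀) = jE (W' - W) * ξ₀ := by rw [map_sub]; ring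
    have hC0 : 0 < Valued.v C := lt_of_le_of_ne zero_le (Ne.symm hC)
    rw [e]
    refine le_of_mul_le_mul_right ?_ hC0
    rw [Valuation.map_mul, hjiso, ← Valuation.map_neg, neg_sub, mul_assoc (Valued.v (jE ϖ) ^ (2 * d - 1)), hS]
    calc Valued.v (W - W') * Valued.v ξ₀ * Valued.v C ≤ r * Valued.v ξ₀ * Valued.v C := by gcongr
      _ ≤ Valued.v (jE ϖ) ^ (2 * d - 1) * y := hr₀
  constructor
  · rintro ⟨hS, hcls⟩
    refine ⟨hsph.1 hS, ?_⟩
    exact (classClause_iff_of_near hD jE hjfix hΘj hjiso hρρ hvρ hΘρ c (hΘκ V hσV) (hΘκ V' hσV') (hκ0 V) (hnear V V' hVV' hS)).2 hcls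
  · rintro ⟨hS', hcls'⟩
    have hS : Valued.v (κ₀ + jE V * ξ₀) * Valued.v C = y := hsph.2 hS'
    refine ⟨hS, ?_⟩
    exact (classClause_iff_of_near hD jE hjfix hΘj hjiso hρρ hvρ hΘρ c (hΘκ V hσV) (hΘκ V' hσV') (hκ0 V) (hnear V V' hVV' hS)).1 hcls'

/-! ## §4 HEAD — ★ F1b's per-cell law carried to the common fine digit system -/

/-- **HEAD — «THE CELL LAW AT THE COMMON RESOLUTION» (K6 ARCHITECTURE A (2)→(3)).**  Chart `(κ₀, ξ₀)` as in §3; the cell's sphere VALUE `y : ℤᵐ⁰` over the scale `C` (`C = jEϖ^j·(α − ρα)`,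
`y = Valued.v (jE ϖ) ^ b` in ★ F1b — then `hPiff := fun _ _ _ => Iff.rfl` at F1b's own lambda); a predicate `P` that agrees with ★ F1b's literal conjunction on fixed integral digits (`hPiff` — take `Iff.rfl` when `P` IS that lambda); the label
`ω(α₁ + γ₁·)` with ★ F1b's letters `hα₁σ hα₁1 hγ₁σ hγ₁1`; two complete irredundant digit systems `Rd` (mod `|ϖ|^n`, the cell's precision) and `Rdf` (mod `|ϖ|^{nf}`, `n ≤ nf`) of the
fixed unit ball; the precision letters at `r := |ϖ|^n` — `hrR`, `hr₀` (conductor-relative), `hrγ`.  THEN ★ F1b's output `X·#(Rd.filter P) = N·(p·Σ_{(Rd.filter P).filter ⊤} ω)` implies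
`X·#(Rdf.filter P) = N·(p·Σ_{Rdf.filter P} ω)` — the `hmul` letter of ★ §3 `cellValue_of_perCellLaw` on the COMMON system. [cite: Kottwitz1986BaseChangeUnits, §1 pp. 240–241]
[cite: Serre1979, Ch. IV §2 Prop. 6; Ch. V §3 Cor. 3 pp. 84–86] [cite: Rogawski1990, §4.9 Prop. 4.9.1 (b) p. 55] -/
theorem cellLaw_fine_of_coarse [CompleteSpace E] {σ : E →+* E} {ϖ : E} {d tE : ℕ} (hD : IsRamifiedQuadraticDatum σ ϖ d tE)
    (jE : E →+* M) (hjfix : ∀ z, ρ z = z ↔ ∃ c, jE c = z) (hΘj : ∀ c, Θ (jE c) = jE (σ c)) (hjiso : ∀ a, Valued.v (jE a) = Valued.v a)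
    (hρρ : ∀ x, ρ (ρ x) = x) (hvρ : ∀ x, Valued.v (ρ x) = Valued.v x) (hΘρ : ∀ x, Θ (ρ x) = ρ (Θ x))
    {κ₀ ξ₀ : M} (hκ₀ : κ₀ + ρ κ₀ = 1) (hΘκ₀ : Θ κ₀ = κ₀) (hκ₀1 : Valued.v κ₀ = 1) (hξ : ρ ξ₀ = -ξ₀) (hΘξ : Θ ξ₀ = ξ₀)
    (c C : M) (y : ℤᵐ⁰) (hC : Valued.v C ≠ 0)
    {α₁ γ₁ : E} (hα₁σ : σ α₁ = α₁) (hα₁1 : Valued.v α₁ = 1) (hγ₁σ : σ γ₁ = γ₁) (hγ₁1 : Valued.v γ₁ < 1)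
    (P : E → Prop) [DecidablePred P]
    (hPiff : ∀ V : E, σ V = V → Valued.v V ≤ 1 →
      (P V ↔ (Valued.v (κ₀ + jE V * ξ₀) * Valued.v C = y ∧ ∃ e : M, ρ e = e ∧ e * Θ e = (κ₀ + jE V * ξ₀) * ρ (κ₀ + jE V * ξ₀) / c)))
    (Rd Rdf : Finset E) {n nf : ℕ} (hle : n ≤ nf)
    (hRd1 : ∀ V ∈ Rd, σ V = V ∧ Valued.v V ≤ 1)
    (hRd2 : ∀ V : E, σ V = V → Valued.v V ≤ 1 → ∃ V₀ ∈ Rd, Valued.v (V - V₀) ≤ Valued.v ϖ ^ n)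
    (hRd3 : ∀ V ∈ Rd, ∀ V' ∈ Rd, Valued.v (V - V') ≤ Valued.v ϖ ^ n → V = V')
    (hRdf1 : ∀ V ∈ Rdf, σ V = V ∧ Valued.v V ≤ 1)
    (hRdf2 : ∀ V : E, σ V = V → Valued.v V ≤ 1 → ∃ V₀ ∈ Rdf, Valued.v (V - V₀) ≤ Valued.v ϖ ^ nf)
    (hRdf3 : ∀ V ∈ Rdf, ∀ V' ∈ Rdf, Valued.v (V - V') ≤ Valued.v ϖ ^ nf → V = V')
    -- the precision letters at `r := |ϖ|^n`
    (hrR : Valued.v ϖ ^ n * Valued.v ξ₀ * Valued.v C < y)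
    (hr₀ : Valued.v ϖ ^ n * Valued.v ξ₀ * Valued.v C ≤ Valued.v (jE ϖ) ^ (2 * d - 1) * y)
    (hrγ : Valued.v γ₁ * Valued.v ϖ ^ n ≤ Valued.v ϖ ^ (2 * d - 1))
    -- ★ F1b's output at the coarse system
    (X N' p : ℤ) (hlaw : X * ((Rd.filter P).card : ℤ) = N' * (p * ∑ V ∈ (Rd.filter P).filter (fun _ => True), normSign σ (α₁ + γ₁ * V))) :
    X * ((Rdf.filter P).card : ℤ) = N' * (p * ∑ V ∈ Rdf.filter P, normSign σ (α₁ + γ₁ * V)) := by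
  obtain ⟨-, -, hϖ, -, -, -, -⟩ := id hD
  refine mul_card_eq_mul_sum_fine_of_coarse hϖ Rd Rdf hle hRd1 hRd2 hRd3 hRdf1 hRdf2 hRdf3 P ?_ (fun V => normSign σ (α₁ + γ₁ * V)) ?_ X N' p hlaw
  · intro V V' hσV hV1 hσV' hV'1 hVV'
    rw [hPiff V hσV hV1, hPiff V' hσV' hV'1]
    exact lit_iff_lit_of_near hD jE hjfix hΘj hjiso hρρ hvρ hΘρ hκ₀ hΘκ₀ hκ₀1 hξ hΘξ c C y hC hrR hr₀ hσV hσV' hVV'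
  · intro V V' hσV hV1 hσV' _ hVV'
    exact (normSign_affine_eq_of_sub_le hD hα₁σ hα₁1 hγ₁σ hγ₁1 hrγ hσV hV1 hσV' hVV').symm

end Summit.HodgeConjecture.HodgeConjecture.Cruxes.H413.F0P3cDyRamCellLawCommonResolution

end
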